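import Literature.Geometry.Lorentzian.NearKerrLeafMinkowski
import HarnessLib

/-!
# Near-Kerr leaves of Minkowski space, II: leaves of FLAT space with `N` holes of arbitrary masses
# (vacuous hole charts at truncation radius `R = M`)

Second junk record for the route-posited predicate `CauchyDevelopment.IsNearKerrLeaf`
(`NearKerrLeaf.lean`; inlined verbatim in the items `QuietLeaves`/`Capture`/`GenericLegs` of
route `FinalStateConjecture/QuietWindowCapture` and `BondiBartnikRigidity`/`GapExhaustion` of
route `FinalStateConjecture/BartnikGapSettling`), companion of `NearKerrLeafMinkowski.lean`:

* `Minkowski.isNearKerrLeaf_hyperboloid_fakeHoles` — for every `k`, every `N` and every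
  `M : Fin N → ℝ` with `0 < M i`, the HONEST unit hyperboloid of the Minkowski development
  (`stretchLeaf 1`, identity flat chart, `Cᵏ` deviation `0`) is a `(0, k)`-near-Kerr leaf with
  `N` holes of masses `M i` and spins `0`. The parameter clause of the predicate asks
  `0 < M i`, `|a i| ≤ M i`, `0 < ρ i < R i` but never relates the truncation radius `R i` to the
  mass; at `R i := M i` the star background's domain `{M i < r}` makes the truncated hole slab
  `{t* = 0, r ≤ R i}`, the near zone, the upper hole layer and the first overlap set EMPTY
  (`truncTimeSlab_restStarBackground_self`), so the `Cᵏ`-closeness-to-Kerr clause and three more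
  hole clauses hold with NO Kerr geometry anywhere (`truncDeviationCk_restStarBackground_self`);
  the one remaining hole clause (the flat band `{t₀ = 0, ρ i < r < R i}` must lie in the hole
  layer's image) is met by an AFFINE junk chart `z ↦ τ ∂₀ + σ z`
  (`hyperboloid_band_subset_fakeChart_image`). So the hole count `N` and the labels `(M, a)` of a
  near-Kerr leaf carry no information (`exists_isNearKerrLeaf_fakeHoles`).
* on the way: the honest barrier clause of the hyperboloidal foliation of Minkowski space
  (`barrier_hyperboloid`: `t₀` does not decrease along causal relations,
  `hypTime_le_of_norm_spatial_sub_le`), so the honest hyperboloid itself is a `(0, k)`-leaf with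
  `0` holes (the case `N = 0`).

Recorded for the planners of the two routes (crux dossier
`Summits/FinalStateConjecture/FinalStateConjecture/Cruxes/BondiBartnikRigidity/ADDENDUM-a1.md`,
§E); nothing here is asserted about any item. Repair suggested there: add `2 * M i ≤ R i` (or
`3 * M i ≤ R i`, matching the thick collars of route `BartnikGapSettling`) to the parameter clause.

## References

* B. O'Neill, *Semi-Riemannian Geometry*, Academic Press 1983, Ch. 14, p. 402 (`I⁺`, `J⁺` of
  Minkowski space). [ONeillSemiRiemannian1983]
* M. Dafermos, G. Holzegel, I. Rodnianski, M. Taylor, arXiv:2104.08222, §1 (closeness to a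
  reference metric in a chart — the vocabulary of `IsNearKerrLeaf`).
  [DafermosHolzegelRodnianskiTaylor2021]
-/

noncomputable section

open Set TopologicalSpace Filter Function
open scoped Manifold ContDiff Topology ENNReal

namespace Literature.Geometry.Lorentzian

namespace Minkowski

/-! ### Fake holes: vacuous hole charts at `R = M` -/

section FakeHoles

/-- The inverse Poincaré map of the trivial motion `(1, c)` is the translation `x ↦ x − c`.
O'Neill 1983, Ch. 9, p. 236. [cite: ONeillSemiRiemannian1983, Ch. 14, p. 402] -/
theorem poincareInv_one (c x : E4) : poincareInv 1 c x = x - c := rfl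

/-- The rest-frame Kerr radius function of a spin-`0` hole at rest at the origin is the spatial
norm: `r(x) = ‖x̲‖`. [folklore] -/
theorem kerrRadius_rest_zero (x : E4) :
    Kerr.radius 0 (poincareInv 1 0 x) = E4.spatialNorm x := by
  rw [poincareInv_one, sub_zero, Kerr.radius_zero_left]

/-- The star background of a spin-`0` hole of mass `M` at rest at the origin, with the rest-frame
Kerr radius: domain `{M < ‖x̲‖}` (for `M > 0`), time `x⁰`, radius `‖x̲‖`. [folklore] -/
def restStarBackground (M : ℝ) : ModelBackground :=
  starBackground 1 0 M 0 fun x => Kerr.radius 0 (poincareInv 1 0 x)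

/-- The time function of the rest star background is `x⁰`. [folklore] -/
@[simp]
theorem restStarBackground_time (M : ℝ) (x : E4) : (restStarBackground M).time x = x 0 := by
  rw [restStarBackground, starBackground_time, poincareInv_one, sub_zero]

/-- The radius function of the rest star background is `‖x̲‖`. [folklore] -/
@[simp]
theorem restStarBackground_radius (M : ℝ) (x : E4) :
    (restStarBackground M).radius x = E4.spatialNorm x := by
  rw [restStarBackground, starBackground_radius, kerrRadius_rest_zero]

/-- Points of the domain of the rest star background of mass `M > 0` have `M < ‖x̲‖`. [folklore] -/
theorem lt_spatialNorm_of_mem_restStarBackground {M : ℝ} (x : (restStarBackground M).domain) :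
    M < E4.spatialNorm x.1 := by
  have hx : poincareInv 1 0 x.1 ∈ Kerr.region 0 M := x.2
  rw [Kerr.mem_region, kerrRadius_rest_zero] at hx
  exact (le_max_left _ _).trans_lt hx

/-- Conversely `M < ‖x̲‖` puts `x` in the domain (for `0 ≤ M`... in general `max M 0 < ‖x̲‖`).
[folklore] -/
theorem mem_restStarBackground_domain {M : ℝ} (hM : 0 ≤ M) {x : E4} (hx : M < E4.spatialNorm x) :
    x ∈ (restStarBackground M).domain := by
  show poincareInv 1 0 x ∈ Kerr.region 0 M
  rw [Kerr.mem_region, kerrRadius_rest_zero, max_eq_left hM]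
  exact hx

/-- **At truncation radius `R = M` the truncated slab of the star background is EMPTY**: its points
would have `‖x̲‖ ≤ M < ‖x̲‖`. This is the loophole of the parameter clause of `IsNearKerrLeaf`
(`ρ < R` but no relation between `R` and `M`). [folklore] -/
theorem truncTimeSlab_restStarBackground_self (M τ : ℝ) :
    (restStarBackground M).truncTimeSlab M τ = ∅ := by
  ext x
  simp only [ModelBackground.mem_truncTimeSlab, restStarBackground_radius, mem_empty_iff_false,
    iff_false, not_and, not_le]
  exact fun _ => lt_spatialNorm_of_mem_restStarBackground x

/-- The `Cᵏ` sup norm over the empty set vanishes. [folklore] -/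
theorem supCkENorm_empty {F G : Type*} [NormedAddCommGroup F] [NormedSpace ℝ F]
    [NormedAddCommGroup G] [NormedSpace ℝ G] (k : ℕ) (f : F → G) : supCkENorm ∅ k f = 0 := by
  simp [supCkENorm]

/-- Hence the truncated `Cᵏ` deviation of ANY chart of the Minkowski development on the rest star
background at `R = M` vanishes — no Kerr geometry is certified by it. [folklore] -/
theorem truncDeviationCk_restStarBackground_self (M : ℝ)
    (Ψ : (restStarBackground M).domain → E4) (k : ℕ) (τ : ℝ) :
    vacuumCauchyDevelopment.toSpacetime.truncDeviationCk (restStarBackground M) Ψ k M τ = 0 := by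
  rw [Spacetime.truncDeviationCk, truncTimeSlab_restStarBackground_self, image_empty,
    supCkENorm_empty]

/-! #### Honest barrier for the unit hyperboloid (`a = 1`) -/

/-- From the causal relation to the cone inequality: `q ∈ J⁻(w)` in the Minkowski development gives
`‖w̲ − q̲‖ ≤ w⁰ − q⁰` (`Minkowski.causalPast_singleton`, transported along the definitional
equalities). O'Neill 1983, Ch. 14, p. 402. [cite: ONeillSemiRiemannian1983, Ch. 14, p. 402] -/
theorem norm_spatial_sub_le_of_mem_causalPast {q w : E4}
    (h : q ∈ (vacuumCauchyDevelopment.metric.causalPast vacuumCauchyDevelopment.timeOrientation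
      ({w} : Set E4) : Set E4)) :
    ‖E4.spatial w - E4.spatial q‖ ≤ w 0 - q 0 :=
  (Set.ext_iff.mp (Minkowski.causalPast_singleton w) q).mp h

/-- A point of the chronological past of a set is in the causal past of one of its points.
O'Neill 1983, Ch. 14, p. 403. [cite: ONeillSemiRiemannian1983, Ch. 14, p. 402] -/
theorem exists_mem_causalPast_of_mem_chronologicalPast {W : Set E4} {q : E4}
    (h : q ∈ (vacuumCauchyDevelopment.metric.chronologicalPast
      vacuumCauchyDevelopment.timeOrientation W : Set E4)) :
    ∃ w ∈ W, q ∈ (vacuumCauchyDevelopment.metric.causalPast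
      vacuumCauchyDevelopment.timeOrientation ({w} : Set E4) : Set E4) := by
  obtain ⟨w, hw, γ, a, b, hab, hγ, hγa, hγb⟩ := h
  exact ⟨w, hw, Or.inr ⟨w, rfl, γ, a, b, hab, hγ.isFutureCausalCurveOn, hγa, hγb⟩⟩

/-- `s ↦ √(1 + s²)` is `1`-Lipschitz: `√(1+u²) ≤ √(1+v²) + |u − v|` (`v ≥ 0`). [folklore] -/
theorem sqrt_one_add_sq_le_add_abs_sub (u v : ℝ) (hv : 0 ≤ v) :
    √(1 + u ^ 2) ≤ √(1 + v ^ 2) + |u - v| := by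
  have hB : 0 ≤ √(1 + v ^ 2) := Real.sqrt_nonneg _
  have hBsq : √(1 + v ^ 2) ^ 2 = 1 + v ^ 2 := Real.sq_sqrt (by positivity)
  have hBv : v ≤ √(1 + v ^ 2) := (le_abs_self v).trans (abs_le_sqrt_one_add_sq v)
  rw [Real.sqrt_le_left (by positivity)]
  have h1 : u ≤ v + |u - v| := by linarith [le_abs_self (u - v)]
  have h2 : -u ≤ v + |u - v| := by linarith [neg_abs_le (u - v)]
  nlinarith [abs_nonneg (u - v), sq_abs u]

/-- The hyperboloidal time does not decrease along causal relations of Minkowski space: if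
`‖w̲ − q̲‖ ≤ w⁰ − q⁰` then `t₀(q) ≤ t₀(w)` (the foliation `{t₀ = τ}` by time-translated unit
hyperboloids is a time function). [folklore] -/
theorem hypTime_le_of_norm_spatial_sub_le {q w : E4} (h : ‖E4.spatial w - E4.spatial q‖ ≤ w 0 - q 0) :
    (hypBackground ⊤).time q ≤ (hypBackground ⊤).time w := by
  rw [hypTime_eq, hypTime_eq]
  have h1 := sqrt_one_add_sq_le_add_abs_sub ‖E4.spatial w‖ ‖E4.spatial q‖ (norm_nonneg _)
  have h2 : |‖E4.spatial w‖ - ‖E4.spatial q‖| ≤ ‖E4.spatial w - E4.spatial q‖ :=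
    abs_norm_sub_norm_le _ _
  linarith

/-- **Barrier clause of the honest hyperboloidal chart.** With `S = {t₀ = 0}` and the upper layer
`W = {0 < t₀ < 1}` (images under the identity chart `stretchChart 1`), every point of `I⁻(W)`
outside `W` lies in `J⁻(S)`: `q ∈ I⁻(W)` gives `t₀(q) ≤ t₀(w) < 1` for some `w ∈ W`, `q ∉ W` then
forces `t₀(q) ≤ 0`, and sliding `q` up by `−t₀(q)` along `∂₀` reaches `S` causally. In particular
`exteriorOf W ∖ W ⊆ J⁻(S)`. O'Neill 1983, Ch. 14, p. 402. [cite: ONeillSemiRiemannian1983, Ch. 14, p. 402] -/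
theorem barrier_hyperboloid {q : E4}
    (hqI : q ∈ (vacuumCauchyDevelopment.metric.chronologicalPast
      vacuumCauchyDevelopment.timeOrientation
      (stretchChart 1 '' {x | 0 < (hypBackground ⊤).time x.1 ∧ (hypBackground ⊤).time x.1 < 1})
        : Set E4))
    (hqW : q ∉ stretchChart 1 '' {x | 0 < (hypBackground ⊤).time x.1 ∧ (hypBackground ⊤).time x.1 < 1}) :
    q ∈ (vacuumCauchyDevelopment.metric.causalPast vacuumCauchyDevelopment.timeOrientation
      (stretchLeaf 1) : Set E4) := by
  obtain ⟨w, ⟨x, hx, rfl⟩, hqw⟩ := exists_mem_causalPast_of_mem_chronologicalPast hqI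
  have hin := norm_spatial_sub_le_of_mem_causalPast hqw
  rw [stretchChart_apply, timeStretch_one] at hin
  have ht1 : (hypBackground ⊤).time q < 1 :=
    (hypTime_le_of_norm_spatial_sub_le hin).trans_lt hx.2
  have ht0 : (hypBackground ⊤).time q ≤ 0 := le_of_not_gt fun hpos =>
    hqW ⟨⟨q, trivial⟩, ⟨hpos, ht1⟩, by rw [stretchChart_apply, timeStretch_one]⟩
  set c : ℝ := (hypBackground ⊤).time q with hc
  set y : (hypBackground ⊤).domain := ⟨q - c • E4.basisVector 0, trivial⟩ with hy
  have hy0 : (hypBackground ⊤).time y.1 = 0 := by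
    rw [hy, hypTime_sub_smul_basisVector, hc, sub_self]
  have hmem : stretchChart 1 y ∈ stretchLeaf 1 := ⟨y, hy0, rfl⟩
  refine LorentzianMetric.causalFuture_mono (g := vacuumCauchyDevelopment.metric)
    (singleton_subset_iff.2 hmem) (mem_causalPast_vacuumCauchyDevelopment ?_)
  rw [stretchChart_apply, timeStretch_one, hy, map_sub, C0Extension.spatial_smul_basisVector,
    sub_zero, sub_self, norm_zero]
  have : (q - c • E4.basisVector 0) 0 = q 0 - c := by simp
  rw [this]
  linarith

/-! #### The affine junk hole chart -/

/-- Scale factor of the fake hole of mass `M`: `σ = (M + ½)/(M + 1) ∈ (0, 1)`. [folklore] -/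
def fakeScale (M : ℝ) : ℝ := (M + 1 / 2) / (M + 1)

/-- Overlap radius of the fake hole of mass `M`: `ρ = σ M < M`. [folklore] -/
def fakeOverlap (M : ℝ) : ℝ := fakeScale M * M

/-- Time offset of the fake hole chart: the midpoint of `(√(1+ρ²), √(1+M²))`. [folklore] -/
def fakeOffset (M : ℝ) : ℝ := (√(1 + fakeOverlap M ^ 2) + √(1 + M ^ 2)) / 2

/-- For `M > 0`: `0 < σ < 1`. [folklore] -/
theorem fakeScale_pos_lt_one {M : ℝ} (hM : 0 < M) : 0 < fakeScale M ∧ fakeScale M < 1 := by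
  refine ⟨by rw [fakeScale]; positivity, ?_⟩
  rw [fakeScale, div_lt_one (by linarith)]
  linarith

/-- The **affine junk chart** of the fake hole of mass `M`: `z ↦ τ ∂₀ + σ z` on the rest star
background (no metric clause constrains it at `R = M`). [folklore] -/
def fakeChart (M : ℝ) : (restStarBackground M).domain → E4 :=
  fun z => fakeOffset M • E4.basisVector 0 + fakeScale M • z.1

/-- Unfolding of the affine junk chart. [folklore] -/
@[simp]
theorem fakeChart_apply (M : ℝ) (z : (restStarBackground M).domain) :
    fakeChart M z = fakeOffset M • E4.basisVector 0 + fakeScale M • z.1 := rfl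

/-- The affine junk chart is `C^∞`. [folklore] -/
theorem contMDiff_fakeChart (M : ℝ) : ContMDiff 𝓘(ℝ, E4) (𝓡 4) ∞ (fakeChart M) :=
  (contDiff_const.add (contDiff_id.const_smul (fakeScale M))).contMDiff.comp
    contMDiff_subtype_val

/-- The affine junk chart restricted to any open subset of the domain is an open embedding (an
affine automorphism after two open inclusions), for `σ ≠ 0`. [folklore] -/
theorem isOpenEmbedding_restrict_fakeChart {M : ℝ} (hσ : fakeScale M ≠ 0)
    {L : Set (restStarBackground M).domain} (hL : IsOpen L) :
    Topology.IsOpenEmbedding (L.restrict (fakeChart M)) := by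
  have h := ((Homeomorph.smulOfNeZero (fakeScale M) hσ).trans
      (Homeomorph.addLeft (fakeOffset M • E4.basisVector 0) : E4 ≃ₜ E4)).isOpenEmbedding.comp
    ((IsOpen.isOpenEmbedding_subtypeVal (restStarBackground M).domain.2).comp
      hL.isOpenEmbedding_subtypeVal)
  exact h

/-! #### The overlap clause of the fake hole: the hyperboloid band is covered by the junk chart -/

/-- For `M > 0`, `(M + 1) σ = M + ½`. [folklore] -/
theorem fakeScale_mul {M : ℝ} (hM : 0 < M) : (M + 1) * fakeScale M = M + 1 / 2 := by
  rw [fakeScale]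
  field_simp

/-- **The second overlap clause of a fake hole holds with the affine junk chart**: the band
`{t₀ = 0, ρ < ‖x̲‖ < M}` of the unit hyperboloid lies in the image of the layer
`{−1 < t* < 1, M < r < M + 1}` under `z ↦ τ ∂₀ + σ z` (preimage point `z = σ⁻¹(y − τ ∂₀)`:
`‖z̲‖ = ‖y̲‖/σ ∈ (M, M + 1)` and `|z⁰| = |y⁰ − τ|/σ < 1` because `y⁰ = √(1+‖y̲‖²)` lies strictly
between `√(1+ρ²)` and `√(1+M²)`, whose half-difference is `≤ (M − ρ)/2 = M/(4(M+1)) < σ`).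
[folklore] -/
theorem hyperboloid_band_subset_fakeChart_image {M : ℝ} (hM : 0 < M) :
    stretchChart 1 '' {x : (hypBackground ⊤).domain | (hypBackground ⊤).time x.1 = 0 ∧
        fakeOverlap M < Kerr.radius 0 (poincareInv 1 0 x.1) ∧
        Kerr.radius 0 (poincareInv 1 0 x.1) < M} ⊆
      fakeChart M '' {z : (restStarBackground M).domain | -1 < (restStarBackground M).time z.1 ∧
        (restStarBackground M).time z.1 < 1 ∧ (restStarBackground M).radius z.1 < M + 1} := by
  rintro _ ⟨x, ⟨hx0, hρy, hyM⟩, rfl⟩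
  rw [kerrRadius_rest_zero] at hρy hyM
  obtain ⟨hσ0, hσ1⟩ := fakeScale_pos_lt_one hM
  have hσM := fakeScale_mul hM
  set σ := fakeScale M with hσ
  set τ := fakeOffset M with hτ
  set y : E4 := x.1 with hy
  set n : ℝ := E4.spatialNorm y with hn
  have hn0 : 0 ≤ n := E4.spatialNorm_nonneg y
  -- the overlap radius `ρ = σ M`
  have hρdef : fakeOverlap M = σ * M := rfl
  rw [hρdef] at hρy
  have hρ0 : 0 < σ * M := mul_pos hσ0 hM
  -- `y⁰ = √(1 + n²)`
  have hy0 : y 0 = √(1 + n ^ 2) := by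
    have h := hx0
    rw [hypTime_eq] at h
    rw [hn, E4.spatialNorm]
    linarith
  -- the time window
  set A := √(1 + (σ * M) ^ 2) with hA
  set Bm := √(1 + M ^ 2) with hBm
  have hτAB : τ = (A + Bm) / 2 := by rw [hτ, fakeOffset, hρdef]
  have hAy : A < y 0 := by
    rw [hy0, hA]
    exact Real.sqrt_lt_sqrt (by positivity) (by nlinarith)
  have hyB : y 0 < Bm := by
    rw [hy0, hBm]
    exact Real.sqrt_lt_sqrt (by positivity) (by nlinarith)
  have hBA : Bm ≤ A + |M - σ * M| := sqrt_one_add_sq_le_add_abs_sub M (σ * M) hρ0.le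
  have hMρ : |M - σ * M| = M * (1 - σ) := by
    rw [abs_of_nonneg (by nlinarith)]
    ring
  have hwin : |y 0 - τ| < σ := by
    rw [abs_lt, hτAB]
    constructor <;> nlinarith
  -- the preimage point
  set z : E4 := σ⁻¹ • (y - τ • E4.basisVector 0) with hz
  have hzsp : E4.spatial z = σ⁻¹ • E4.spatial y := by
    rw [hz, map_smul, map_sub, C0Extension.spatial_smul_basisVector, sub_zero]
  have hzn : E4.spatialNorm z = n / σ := by
    rw [E4.spatialNorm, hzsp, norm_smul, Real.norm_eq_abs, abs_inv, abs_of_pos hσ0, hn,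
      E4.spatialNorm, inv_mul_eq_div]
  have hz0 : z 0 = (y 0 - τ) / σ := by
    have : (y - τ • E4.basisVector 0) 0 = y 0 - τ := by simp
    rw [hz, PiLp.smul_apply, this, smul_eq_mul, inv_mul_eq_div]
  have hMz : M < E4.spatialNorm z := by
    rw [hzn, lt_div_iff₀ hσ0]
    linarith
  have hzR : E4.spatialNorm z < M + 1 := by
    rw [hzn, div_lt_iff₀ hσ0]
    nlinarith
  have hz0abs : |z 0| < 1 := by
    rw [hz0, abs_div, abs_of_pos hσ0, div_lt_one hσ0]
    exact hwin
  refine ⟨⟨z, mem_restStarBackground_domain hM.le hMz⟩, ⟨?_, ?_, ?_⟩, ?_⟩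
  · rw [restStarBackground_time]
    exact (abs_lt.1 hz0abs).1
  · rw [restStarBackground_time]
    exact (abs_lt.1 hz0abs).2
  · rw [restStarBackground_radius]
    exact hzR
  · show τ • E4.basisVector 0 + σ • z = stretchChart 1 x
    rw [stretchChart_apply, timeStretch_one, ← hy, hz, smul_smul, mul_inv_cancel₀ hσ0.ne',
      one_smul, add_sub_cancel]

/-! #### Leaves of flat space with fake holes of arbitrary masses -/

/-- The layer `{−1 < t* < 1, r < M + 1}` of the rest star background is open. [folklore] -/
theorem isOpen_fakeLayer (M : ℝ) :
    IsOpen {z : (restStarBackground M).domain | -1 < (restStarBackground M).time z.1 ∧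
      (restStarBackground M).time z.1 < 1 ∧ (restStarBackground M).radius z.1 < M + 1} := by
  have ht : Continuous fun z : (restStarBackground M).domain => (restStarBackground M).time z.1 := by
    simp only [restStarBackground_time]
    exact (EuclideanSpace.proj (0 : Fin 4)).continuous.comp continuous_subtype_val
  have hr : Continuous fun z : (restStarBackground M).domain =>
      (restStarBackground M).radius z.1 := by
    simp only [restStarBackground_radius]
    exact (continuous_norm.comp E4.spatial.continuous).comp continuous_subtype_val
  exact (isOpen_lt continuous_const ht).inter
    ((isOpen_lt ht continuous_const).inter (isOpen_lt hr continuous_const))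

/-- The image of the fake layer under the affine junk chart lies at positive times, hence in
`J⁺({x⁰ = 0})`: `(τ ∂₀ + σ z)⁰ = τ + σ z⁰ > τ − σ > 0` (`τ ≥ 1 > σ`). [folklore] -/
theorem fakeChart_image_subset_causalFuture {M : ℝ} (hM : 0 < M) :
    fakeChart M '' {z : (restStarBackground M).domain | -1 < (restStarBackground M).time z.1 ∧
        (restStarBackground M).time z.1 < 1 ∧ (restStarBackground M).radius z.1 < M + 1} ⊆
      (vacuumCauchyDevelopment.metric.causalFuture vacuumCauchyDevelopment.timeOrientation
        (range vacuumCauchyDevelopment.toCauchyDevelopment.embed) : Set E4) := by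
  rintro _ ⟨z, ⟨hz1, -, -⟩, rfl⟩
  rw [restStarBackground_time] at hz1
  obtain ⟨hσ0, hσ1⟩ := fakeScale_pos_lt_one hM
  have hτ1 : 1 ≤ fakeOffset M := by
    rw [fakeOffset]
    have h1 : (1 : ℝ) ≤ √(1 + fakeOverlap M ^ 2) :=
      (Real.le_sqrt zero_le_one (by positivity)).2 (by nlinarith)
    have h2 : (1 : ℝ) ≤ √(1 + M ^ 2) :=
      (Real.le_sqrt zero_le_one (by positivity)).2 (by nlinarith)
    linarith
  set w : E4 := fakeOffset M • E4.basisVector 0 + fakeScale M • z.1 with hw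
  set p : E4 := E4.ofTimeSpace 0 (E4.spatial w) with hp
  have hpr : p ∈ range vacuumCauchyDevelopment.toCauchyDevelopment.embed := by
    change p ∈ range sliceEmbed
    rw [E4.mem_range_sliceEmbed_iff]
    simp [hp]
  refine LorentzianMetric.causalFuture_mono (g := vacuumCauchyDevelopment.metric)
    (singleton_subset_iff.2 hpr) (mem_causalFuture_vacuumCauchyDevelopment ?_)
  rw [fakeChart_apply, ← hw, hp, E4.spatial_ofTimeSpace, sub_self, norm_zero,
    E4.ofTimeSpace_apply_zero, sub_zero]
  have hw0 : w 0 = fakeOffset M + fakeScale M * z.1 0 := by simp [hw]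
  rw [hw0]
  nlinarith

/-- **Near-"Kerr" leaves with `N` holes of ARBITRARY masses in flat space.** For every `k`, every
`N` and every `M : Fin N → ℝ` with `0 < M i`, the honest unit hyperboloid `stretchLeaf 1` of the
Minkowski development is a `(0, k)`-near-Kerr leaf with `N` holes of masses `M i` and spins `0`:
take `R i := M i` — then the truncated hole slab `{t* = 0, M i < r ≤ R i}`, the near zone, the
upper hole layer and the first overlap set are all EMPTY, so no clause ever compares the
spacetime with Kerr — overlap radii `ρ i := σ i M i`, and the affine junk charts `fakeChart (M i)`
for the one remaining non-vacuous hole clause (`hyperboloid_band_subset_fakeChart_image`). The flat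
part is the honest identity chart (`Cᵏ` deviation `0`, barrier `barrier_hyperboloid`). Hence the
hole count `N` and the mass labels of a near-Kerr leaf carry no information (the parameter clause
relates `ρ < R` but never `R` to `M`). Recorded for the planners (crux dossier
`Cruxes/BondiBartnikRigidity/ADDENDUM-a1.md`, §E); DHRT arXiv:2104.08222, §1 (the vocabulary).
[cite: DafermosHolzegelRodnianskiTaylor2021, §1] -/
theorem isNearKerrLeaf_hyperboloid_fakeHoles (k N : ℕ) (M : Fin N → ℝ) (hM : ∀ i, 0 < M i) :
    vacuumCauchyDevelopment.toCauchyDevelopment.IsNearKerrLeaf k 0 N M (fun _ => 0)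
      (stretchLeaf 1) := by
  -- the flat layer
  set L₀ : Set (hypBackground ⊤).domain :=
    {x | -1 < (hypBackground ⊤).time x.1 ∧ (hypBackground ⊤).time x.1 < 1} with hL₀
  have hL₀open : IsOpen L₀ :=
    isOpen_Ioo.preimage (continuous_hypTime.comp continuous_subtype_val)
  -- empty hole pieces
  have hslab : ∀ i, (restStarBackground (M i)).truncTimeSlab (M i) 0 = ∅ := fun i =>
    truncTimeSlab_restStarBackground_self (M i) 0
  have hWempty : ∀ i, fakeChart (M i) '' {z : (restStarBackground (M i)).domain |
      0 < (restStarBackground (M i)).time z.1 ∧ (restStarBackground (M i)).time z.1 < 1 ∧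
      (restStarBackground (M i)).radius z.1 ≤ M i} = ∅ := fun i => by
    rw [image_eq_empty]
    ext z
    simp only [mem_setOf_eq, mem_empty_iff_false, iff_false, not_and, not_le,
      restStarBackground_radius]
    exact fun _ _ => lt_spatialNorm_of_mem_restStarBackground z
  refine ⟨M, fun i => fakeOverlap (M i), fun _ => (1, 0),
    fun _ x => Kerr.radius 0 (poincareInv 1 0 x), fun i => restStarBackground (M i), ⊤,
    hypBackground ⊤, fun i => fakeChart (M i), stretchChart 1,
    fun i => {z | -1 < (restStarBackground (M i)).time z.1 ∧
      (restStarBackground (M i)).time z.1 < 1 ∧ (restStarBackground (M i)).radius z.1 < M i + 1},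
    fun i => {z | 0 < (restStarBackground (M i)).time z.1 ∧
      (restStarBackground (M i)).time z.1 < 1 ∧ (restStarBackground (M i)).radius z.1 ≤ M i},
    L₀, {x | 0 < (hypBackground ⊤).time x.1 ∧ (hypBackground ⊤).time x.1 < 1}, ?_⟩
  refine ⟨fun i => rfl, fun i => rfl, rfl, fun i => ⟨rfl, rfl⟩, rfl, rfl, fun i => ?_,
    fun x _ => trivial, fun i => ?_, (contMDiff_stretchChart 1).contMDiffOn, ?_, ?_,
    fun i => ?_, ?_, ?_, fun i => ?_, fun i => ?_, ?_, ?_, ?_⟩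
  · -- parameters: `0 < M`, `|0| ≤ M`, `0 < ρ < R = M`
    obtain ⟨hσ0, hσ1⟩ := fakeScale_pos_lt_one (hM i)
    refine ⟨hM i, by rw [abs_zero]; exact (hM i).le, mul_pos hσ0 (hM i), ?_⟩
    exact mul_lt_of_lt_one_left (hM i) hσ1
  · -- hole charts: smooth, open embeddings of their layers, images in `J⁺`
    exact ⟨(contMDiff_fakeChart (M i)).contMDiffOn,
      isOpenEmbedding_restrict_fakeChart (fakeScale_pos_lt_one (hM i)).1.ne' (isOpen_fakeLayer _),
      fakeChart_image_subset_causalFuture (hM i)⟩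
  · -- flat chart: open embedding of the layer
    have h := (timeStretchEquiv 1 one_ne_zero).toHomeomorph.isOpenEmbedding.comp
      ((IsOpen.isOpenEmbedding_subtypeVal (⊤ : Opens E4).2).comp
        hL₀open.isOpenEmbedding_subtypeVal)
    exact h
  · -- flat chart: layer image in `J⁺({x⁰ = 0})`
    rintro _ ⟨x, hx, rfl⟩
    have hx0 : 0 < x.1 0 := pos_of_neg_one_lt_hypTime hx.1
    set p : E4 := E4.ofTimeSpace 0 (E4.spatial (timeStretch 1 x.1)) with hp
    have hpr : p ∈ range vacuumCauchyDevelopment.toCauchyDevelopment.embed := by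
      change p ∈ range sliceEmbed
      rw [E4.mem_range_sliceEmbed_iff]
      simp [hp]
    refine LorentzianMetric.causalFuture_mono (g := vacuumCauchyDevelopment.metric)
      (singleton_subset_iff.2 hpr) (mem_causalFuture_vacuumCauchyDevelopment ?_)
    rw [stretchChart_apply, hp, E4.spatial_ofTimeSpace, sub_self, norm_zero,
      E4.ofTimeSpace_apply_zero, sub_zero, timeStretch_apply_zero]
    positivity
  · -- hole charts: the truncated slabs are empty, so the truncated deviation is `0`
    exact (truncDeviationCk_restStarBackground_self (M i) (fakeChart (M i)) k 0).le
  · -- flat chart: `Cᵏ` deviation `0`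
    refine (deviationCk_stretchChart_le 1 k 0).trans (le_of_eq ?_)
    norm_num
  · -- near zones are empty, hence pairwise disjoint
    intro i j _
    refine Set.disjoint_left.2 ?_
    rintro _ ⟨z, ⟨-, hz⟩, rfl⟩
    rw [restStarBackground_radius] at hz
    exact absurd hz (not_le.2 (lt_spatialNorm_of_mem_restStarBackground z))
  · -- first overlap sets are empty
    rintro _ ⟨z, ⟨-, -, hz⟩, rfl⟩
    rw [restStarBackground_radius] at hz
    exact absurd hz (not_le.2 (lt_spatialNorm_of_mem_restStarBackground z))
  · -- second overlap clause: the hyperboloid band is covered by the junk chart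
    exact hyperboloid_band_subset_fakeChart_image (hM i)
  · -- the leaf is the flat slab image (hole slabs are empty)
    simp only [hslab, image_empty, iUnion_empty, union_empty]
    rfl
  · -- upper layers lie in `I⁺(S)` (hole layers are empty; slide flat points down to the slab)
    refine union_subset ?_ (iUnion_subset fun i => ?_)
    swap
    · rintro _ ⟨z, ⟨-, -, hz⟩, rfl⟩
      rw [restStarBackground_radius] at hz
      exact absurd hz (not_le.2 (lt_spatialNorm_of_mem_restStarBackground z))
    rintro _ ⟨x, hx, rfl⟩
    set c : ℝ := (hypBackground ⊤).time x.1 with hc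
    set x' : (hypBackground ⊤).domain := ⟨x.1 - c • E4.basisVector 0, trivial⟩ with hx'
    have hx'0 : (hypBackground ⊤).time x'.1 = 0 := by
      rw [hx', hypTime_sub_smul_basisVector, hc, sub_self]
    have hmem : stretchChart 1 x' ∈ stretchLeaf 1 := ⟨x', hx'0, rfl⟩
    refine LorentzianMetric.chronologicalFuture_mono (g := vacuumCauchyDevelopment.metric)
      (singleton_subset_iff.2 hmem) (mem_chronologicalFuture_of_norm_lt ?_)
    rw [stretchChart_apply, stretchChart_apply, spatial_timeStretch, spatial_timeStretch, hx',
      map_sub, C0Extension.spatial_smul_basisVector, sub_zero, sub_self, norm_zero,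
      timeStretch_apply_zero, timeStretch_apply_zero]
    have : (x.1 - c • E4.basisVector 0) 0 = x.1 0 - c := by simp
    rw [this]
    nlinarith [hx.1]
  · -- barrier clause (hole layers are empty; honest hyperboloid barrier)
    rintro q ⟨hqE, hqW⟩
    have hqI := ((CauchyDevelopment.mem_exteriorOf_iff _ _ _).1 hqE).2
    have hsub : (stretchChart 1 '' {x : (hypBackground ⊤).domain |
          0 < (hypBackground ⊤).time x.1 ∧ (hypBackground ⊤).time x.1 < 1} ∪
        ⋃ i, fakeChart (M i) '' {z : (restStarBackground (M i)).domain |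
          0 < (restStarBackground (M i)).time z.1 ∧ (restStarBackground (M i)).time z.1 < 1 ∧
          (restStarBackground (M i)).radius z.1 ≤ M i}) ⊆
        stretchChart 1 '' {x : (hypBackground ⊤).domain |
          0 < (hypBackground ⊤).time x.1 ∧ (hypBackground ⊤).time x.1 < 1} :=
      union_subset subset_rfl (iUnion_subset fun i => by rw [hWempty i]; exact empty_subset _)
    exact barrier_hyperboloid
      (LorentzianMetric.chronologicalFuture_mono (g := vacuumCauchyDevelopment.metric) hsub hqI)
      fun h => hqW (Or.inl h)

/-- Hence **for every `N` and all masses `M i > 0`, flat space has a `(0, k)`-near-Kerr leaf with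
`N` holes** (anti-information record for the hole count and labels). [folklore] -/
theorem exists_isNearKerrLeaf_fakeHoles (k N : ℕ) (M : Fin N → ℝ) (hM : ∀ i, 0 < M i) :
    ∃ S : Set E4, vacuumCauchyDevelopment.toCauchyDevelopment.IsNearKerrLeaf k 0 N M (fun _ => 0) S :=
  ⟨_, isNearKerrLeaf_hyperboloid_fakeHoles k N M hM⟩

end FakeHoles

end Minkowski

end Literature.Geometry.Lorentzian

end
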